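import Mathlib.Analysis.SpecialFunctions.Pow.Real
import Mathlib.Algebra.Order.BigOperators.Group.Finset
import HarnessLib

/-!
# S2β · pairing lane ((ST) ⟸ the relative two-profile sup recursion) — (W2) THE WEIGHTED TWO-PROFILE TOWER SUM: an UPWARD recursion
# `m_{t+1} ≤ T₁₁m_t + T₁₂v_t + a_{t+1}`, `v_{t+1} ≤ T₂₁m_t + T₂₂v_t + b_{t+1}` with `L·ρ_λ(T)² < 1` gives `Σ_{t<k} L^t·m_t² ≤ C·Σ_{t<k} L^t·(a_t² + λ²b_t²)`, `C` K-FREE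

Cell `ym3-torus` (rung R3 = continuum `SU(2)` Yang–Mills on the three-torus — NOT d = 4, NOT infinite volume, NOT a mass gap, NOT Clay).
Width seat «width 21» `ym3-torus-px21` (gen 24); `--kind proof --supports stmt-QuantumFields-20520 --as helper`, count-neutral, DEFINITION-FREE
(0 `def`, 0 `instance`, 0 `notation`, 0 `sorry`, default heartbeats).  Mathlib-only real-sequence algebra; the (ST)-currency twin of px21 g23's
✓`…ContractingSupVarStart.sup_bootstrap_two_profile` (which is DOWNWARD, linear, with a start) and of px16 g20's ✓`…ContractingSupRecursion.sum_le_of_contract`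
(downward, linear, `s m = 0`): here the recursion runs UPWARD (coarse → fine, `t = 0 ↔` level `J+1`, chord `0` below it on the fibre), the budget is QUADRATIC and
carries (ST)'s weights `L^t`.

WHY (px16 g22 17:10:38Z «DECISIVE NUMBER: `L·ρ(T)² < 1` for the 2×2 linear recursion matrix `T`»; px17 g22 UV3-NODE §94.4–94.5; px21 g24 17:12:51Z `ρ(T) ≈ 0.37`).
The sup-tower letter (ST) (px17 g22 ⧗`…LocalOfSupTower`'s `hSTL`) bounds `Σ_{t<k} L^t·Σ_B max_{READ_t(B)} ‖η⁽ᴶ⁺ᵗ⁺¹⁾‖²` by the pair's purse.  Its discharger is a recursion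
from level `J` (fibre: chord `0`) upward: per level the (aggregated) relative sup chord `m_t` and adjacent-transverse-difference profile `v_t` obey a linear 2×2 step with
matrix `T` (comb rows: ✓p829341∕✓p829498 `c_lift·L⁻¹`, `L⁻²`; rung rows: Q11a∕Q11a′ + the translate-ladder closure) plus sources (relative plaquettes, priced by the purse).
THIS FILE is the algebra that turns «`L·q² < 1`» into the K-uniform weighted budget, with every constant explicit:
* §1 ★ `sq_le_of_le_mul_add` (Young): `0 ≤ u ≤ q·u′ + s`, `q, u′ ≥ 0`, `ε > 0` ⟹ `u² ≤ (1+ε)·q²·u′² + (1+ε⁻¹)·s²`.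
* §2 ★★ `weighted_tower_sum_le_of_start` — ONE profile, squared currency: `X (t+1) ≤ α·X t + C (t+1)`, `X 0 ≤ C 0`, `X ≥ 0`, `L·α ≤ r < 1` ⟹
  `Σ_{t<k} L^t·X t ≤ (Σ_{t<k} L^t·C t)∕(1 − r)` for EVERY `k` (the constant does not see `k`).
  ★★ `weighted_tower_sum_le` — the LANE EDITION (px16 g22 shape (i)): no start hypothesis, `Σ_{t<k} L^t·x t ≤ (x 0 + Σ_{t<k} L^t·s t)∕(1 − L·q)` under `L·q < 1`;
  ★★ `weighted_tower_sum_le_of_combined` — shape (ii): from ONE line `m(t+1) + λv(t+1) ≤ q·(m t + λv t) + σ(t+1)` the budget for `m` alone.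
* §3 ★★ `max_profile_step` — TWO profiles to one: with `λ > 0` and `q := max (T₁₁ + T₁₂∕λ) (λ·T₂₁ + T₂₂)` (`T ≥ 0`), `u t := max (m t) (λ·v t)` obeys
  `u (t+1) ≤ q·u t + max (a (t+1)) (λ·b (t+1))`.
* §4 ★★★ `weighted_two_profile_sum_le` — THE BUDGET: nonneg `m, a`, the 2×2 step for all `t`, `m 0 ≤ a 0`, `v 0 ≤ b 0`, `λ > 0`, `ε > 0`,
  `L·(1+ε)·q² ≤ r < 1` ⟹ **`Σ_{t<k} L^t·(m t)² ≤ ((1+ε⁻¹)∕(1−r))·Σ_{t<k} L^t·((a t)² + λ²·(b t)²)`** for every `k` (and the same for `λ²·(v t)²`).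
READING (numbers of record, `L = 5`, `d = 3`; px21 g24 17:12:51Z, px16 g22 17:16:58Z): `T ≈ [[c_lift∕L, ℓ_lad∕L²], [2c_lift·s∕L², (1+2ℓ″)∕L²]] ≈ [[0.2–0.32, 0.16], [≤ 0.03, 0.36]]`;
`λ = 1` gives `q = max(0.36–0.48, 0.39)`, i.e. `q ≈ 0.39` (log∕log `c_lift = 1`) ∕ `0.48` (chord, `π∕2`): `L·q² ≈ 0.76` ✓ ∕ `1.15` ✗ — so the discharger wants the
log∕log-difference currency for the comb row (✓p829341 `dist1_lift_rel_le_of_logVec_sub`, `c_lift = 1`) AND `T₂₂ < L^{−1∕2} ≈ 0.447`: the crude translate-ladder count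
`(1 + 2ℓ″)∕25` passes for `ℓ″ ≤ 4` (`0.36`), is borderline at `ℓ″ = 5` (`0.44`) and fails at `ℓ″ ≥ 6` — THE EXACT SECOND-DIFFERENCE COUNT `ℓ″` OF THE WORST PAIR CLASS IS
LOAD-BEARING (a third profile of second transverse differences would give `(1+ℓ″)∕L²` instead; the two-level-block step `L² = 25` is the other cure).  With `q = 0.39`, `ε = 0.15`:
`r = 0.874`, constant `(1+ε⁻¹)∕(1−r) ≈ 61`, K-free.

HONEST SCOPE.  Elementary inequalities; the matrix `T`, its entries and the count `ℓ″` are NOT established here (kinematics of the (SCT)→(ST) file); nothing of Bałaban's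
analysis is asserted ([Balaban1985Averaging] Prop. 4 (134)–(135) p.38 with (128)–(133) pp.37–38: the printed k-uniform SUP recursion this budget transcribes); (ST), LOC, AVG₂♭-ax_q,
D-GUARD, GAP♯∘ (`stub_uniformFibreGapOrbit`, registry untouched, 0∕5), S2β, crux 20520 and `YM3TorusSU2` are NOT proved; no registered stub is closed; rung R3 = SU(2) YM₃ on
T³ — NOT d = 4, NOT infinite volume, NOT a mass gap, NOT Clay; the Yang–Mills mass gap is NOT proved.
References: T. Bałaban, CMP **98** (1985) 17–51 [Balaban1985Averaging]; CMP **109** (1987) 249–301 [Balaban1987RG1].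
-/

set_option autoImplicit false

namespace Summit.QuantumFields.YangMills.Theorems.FluctuationComparisonRegPrIntLS2BetaWeightedTwoProfileTowerSum

open Finset

/-! ## §1 Young squaring of a linear step -/

/-- ★ **YOUNG SQUARING**: `0 ≤ u ≤ q·u′ + s` with `q, u′ ≥ 0` and `ε > 0` ⟹ `u² ≤ (1+ε)·q²·u′² + (1+ε⁻¹)·s²`
(`2xy ≤ ε x² + ε⁻¹ y²`). [folklore] -/
theorem sq_le_of_le_mul_add {u u' q s ε : ℝ} (hu : 0 ≤ u) (hq : 0 ≤ q) (hu' : 0 ≤ u') (hε : 0 < ε)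
    (h : u ≤ q * u' + s) : u ^ 2 ≤ (1 + ε) * q ^ 2 * u' ^ 2 + (1 + ε⁻¹) * s ^ 2 := by
  have hx : 0 ≤ q * u' := mul_nonneg hq hu'
  have h1 : u ^ 2 ≤ (q * u' + s) ^ 2 := pow_le_pow_left₀ hu h 2
  -- `2·(q u′)·s ≤ ε (q u′)² + ε⁻¹ s²`
  have hy : 2 * (q * u') * s ≤ ε * (q * u') ^ 2 + ε⁻¹ * s ^ 2 := by
    have hε' : 0 < ε⁻¹ := inv_pos.mpr hε
    have key : 0 ≤ (Real.sqrt ε * (q * u') - Real.sqrt ε⁻¹ * s) ^ 2 := sq_nonneg _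
    have e1 : Real.sqrt ε ^ 2 = ε := Real.sq_sqrt hε.le
    have e2 : Real.sqrt ε⁻¹ ^ 2 = ε⁻¹ := Real.sq_sqrt hε'.le
    have e3 : Real.sqrt ε * Real.sqrt ε⁻¹ = 1 := by
      rw [← Real.sqrt_mul hε.le, mul_inv_cancel₀ hε.ne', Real.sqrt_one]
    nlinarith [key, e1, e2, e3]
  nlinarith [h1, hy]

/-! ## §2 One profile, squared currency: the weighted upward budget -/

/-- ★★ **THE WEIGHTED UPWARD BUDGET, ONE PROFILE**: `X (t+1) ≤ α·X t + C (t+1)` for all `t`, `X 0 ≤ C 0`, `X ≥ 0`, `0 ≤ α`, `L ≥ 0`, `L·α ≤ r < 1` ⟹ for every `k`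
    `Σ_{t<k} L^t·X t ≤ (Σ_{t<k} L^t·C t)∕(1 − r)`
— the constant does not see `k` (K-uniformity).  Proof: `L^{t+1}X_{t+1} ≤ r·L^tX_t + L^{t+1}C_{t+1}`, summed. [cite: Balaban1985Averaging, Prop. 4 (134)-(135) p.38] -/
theorem weighted_tower_sum_le_of_start (X C : ℕ → ℝ) {α L r : ℝ} (hX0 : ∀ t, 0 ≤ X t) (hα : 0 ≤ α) (hL : 0 ≤ L)
    (hr : L * α ≤ r) (hr1 : r < 1) (hstart : X 0 ≤ C 0) (hstep : ∀ t, X (t + 1) ≤ α * X t + C (t + 1)) (k : ℕ) :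
    ∑ t ∈ range k, L ^ t * X t ≤ (∑ t ∈ range k, L ^ t * C t) / (1 - r) := by
  have hr0 : 0 ≤ r := (mul_nonneg hL hα).trans hr
  rw [le_div_iff₀ (by linarith), mul_sub, mul_one]
  -- claim by induction on k: S_k - r S_k ≤ Σ L^t C_t, in the stronger form S_k ≤ r·(S_k − L^{k−1}X_{k−1}) + ΣC … ; do it directly:
  suffices h : ∀ k, ∑ t ∈ range k, L ^ t * X t ≤ r * ∑ t ∈ range k, L ^ t * X t + ∑ t ∈ range k, L ^ t * C t -
      (if k = 0 then 0 else r * (L ^ (k - 1) * X (k - 1))) by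
    have hk := h k
    have hnn : 0 ≤ (if k = 0 then 0 else r * (L ^ (k - 1) * X (k - 1))) := by
      split_ifs
      · exact le_rfl
      · exact mul_nonneg hr0 (mul_nonneg (pow_nonneg hL _) (hX0 _))
    linarith
  intro k
  induction k with
  | zero => simp
  | succ k ih =>
    rw [sum_range_succ, sum_range_succ]
    simp only [Nat.succ_ne_zero, if_false, Nat.add_sub_cancel]
    rcases Nat.eq_zero_or_pos k with hk | hk
    · subst hk
      simp only [range_zero, sum_empty, pow_zero, one_mul, zero_add, if_true] at ih ⊢
      nlinarith [hstart, hX0 0, hr0]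
    · have hk' : k ≠ 0 := by omega
      rw [if_neg hk'] at ih
      obtain ⟨j, rfl⟩ : ∃ j, k = j + 1 := ⟨k - 1, by omega⟩
      simp only [Nat.add_sub_cancel] at ih
      -- the new term: L^{j+1} X_{j+1} ≤ r·L^j X_j + L^{j+1} C_{j+1}
      have hnew : L ^ (j + 1) * X (j + 1) ≤ r * (L ^ j * X j) + L ^ (j + 1) * C (j + 1) := by
        have h1 := mul_le_mul_of_nonneg_left (hstep j) (pow_nonneg hL (j + 1))
        have h2 : L ^ (j + 1) * (α * X j) = (L * α) * (L ^ j * X j) := by ring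
        have h3 : (L * α) * (L ^ j * X j) ≤ r * (L ^ j * X j) :=
          mul_le_mul_of_nonneg_right hr (mul_nonneg (pow_nonneg hL _) (hX0 _))
        nlinarith [h1, h2, h3]
      have hXj : 0 ≤ L ^ (j + 1) * X (j + 1) := mul_nonneg (pow_nonneg hL _) (hX0 _)
      nlinarith [ih, hnew, hXj, hr0]

/-- ★★ **THE WEIGHTED UPWARD BUDGET, LANE EDITION** (px16 g22 17:17:51Z shape (i), no start hypothesis): `0 ≤ x`, `0 ≤ s`, `x (t+1) ≤ q·x t + s (t+1)`, `0 ≤ q`,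
`0 ≤ L`, `L·q < 1` ⟹ for every `k`
    `Σ_{t<k} L^t·x t ≤ (x 0 + Σ_{t<k} L^t·s t)∕(1 − L·q)`.
In (ST)'s squared currency take `x t := M_t²`-type aggregates and `q := (1+ε)·ρ²` (§1); the constant does not see `k`. [cite: Balaban1985Averaging, Prop. 4 (134)-(135) p.38] -/
theorem weighted_tower_sum_le (x s : ℕ → ℝ) {q L : ℝ} (hx0 : ∀ t, 0 ≤ x t) (hs0 : ∀ t, 0 ≤ s t) (hq : 0 ≤ q) (hL : 0 ≤ L)
    (hLq : L * q < 1) (hstep : ∀ t, x (t + 1) ≤ q * x t + s (t + 1)) (k : ℕ) :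
    ∑ t ∈ range k, L ^ t * x t ≤ (x 0 + ∑ t ∈ range k, L ^ t * s t) / (1 - L * q) := by
  -- apply the start edition to `C t := if t = 0 then x 0 + s 0 else s t`
  have h := weighted_tower_sum_le_of_start x (fun t => if t = 0 then x 0 + s 0 else s t) hx0 hq hL le_rfl hLq
    (by simp only [if_true]; linarith [hs0 0]) (fun t => by simp only [Nat.succ_ne_zero, if_false]; exact hstep t) k
  refine h.trans (div_le_div_of_nonneg_right ?_ (by linarith))
  rcases Nat.eq_zero_or_pos k with hk | hk
  · subst hk; simp [hx0 0]
  · obtain ⟨j, rfl⟩ : ∃ j, k = j + 1 := ⟨k - 1, by omega⟩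
    rw [sum_range_succ', sum_range_succ']
    simp only [Nat.succ_ne_zero, if_false, if_true, pow_zero, one_mul]
    linarith

/-- ★★ **TWO PROFILES DOCKED THROUGH A COMBINED PROFILE** (px16 g22 17:17:51Z shape (ii)): nonneg `m`, `λ·v ≥ 0`, and ONE line from the typist's `T` and `λ`,
`hq : ∀ t, m (t+1) + λ·v (t+1) ≤ q·(m t + λ·v t) + σ (t+1)` (`σ ≥ 0`, `0 ≤ q`, `L·q < 1`) ⟹
    `Σ_{t<k} L^t·m t ≤ Σ_{t<k} L^t·(m t + λ·v t) ≤ (m 0 + λ·v 0 + Σ_{t<k} L^t·σ t)∕(1 − L·q)`. [cite: Balaban1985Averaging, Prop. 4 (134)-(135) p.38] -/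
theorem weighted_tower_sum_le_of_combined (m v σ : ℕ → ℝ) {q L lam : ℝ} (hm0 : ∀ t, 0 ≤ m t) (hv0 : ∀ t, 0 ≤ lam * v t) (hσ0 : ∀ t, 0 ≤ σ t)
    (hq : 0 ≤ q) (hL : 0 ≤ L) (hLq : L * q < 1)
    (hstep : ∀ t, m (t + 1) + lam * v (t + 1) ≤ q * (m t + lam * v t) + σ (t + 1)) (k : ℕ) :
    ∑ t ∈ range k, L ^ t * m t ≤ (m 0 + lam * v 0 + ∑ t ∈ range k, L ^ t * σ t) / (1 - L * q) := by
  have h := weighted_tower_sum_le (fun t => m t + lam * v t) σ (fun t => add_nonneg (hm0 t) (hv0 t)) hσ0 hq hL hLq hstep k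
  refine le_trans (sum_le_sum fun t _ => mul_le_mul_of_nonneg_left ?_ (pow_nonneg hL _)) h
  linarith [hv0 t]

/-! ## §3 Two profiles to one: the `λ`-weighted max profile -/

/-- ★★ **THE `λ`-WEIGHTED MAX PROFILE CONTRACTS WITH `q = ‖T‖_λ`**: for nonneg `T_{ij}`, `λ > 0`, `q := max (T₁₁ + T₁₂∕λ) (λ·T₂₁ + T₂₂)`, `m′ ≥ 0` and
`m ≤ T₁₁m′ + T₁₂v′ + a`, `v ≤ T₂₁m′ + T₂₂v′ + b`:  `max m (λ·v) ≤ q·max m′ (λ·v′) + max a (λ·b)`. [folklore] -/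
theorem max_profile_step {T₁₁ T₁₂ T₂₁ T₂₂ lam m v m' v' a b : ℝ} (h11 : 0 ≤ T₁₁) (h12 : 0 ≤ T₁₂) (h21 : 0 ≤ T₂₁) (h22 : 0 ≤ T₂₂)
    (hlam : 0 < lam) (hm' : 0 ≤ m')
    (hm : m ≤ T₁₁ * m' + T₁₂ * v' + a) (hv : v ≤ T₂₁ * m' + T₂₂ * v' + b) :
    max m (lam * v) ≤ max (T₁₁ + T₁₂ / lam) (lam * T₂₁ + T₂₂) * max m' (lam * v') + max a (lam * b) := by
  set u' := max m' (lam * v') with hu'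
  have hm'u : m' ≤ u' := le_max_left _ _
  have hv'u : lam * v' ≤ u' := le_max_right _ _
  have hu'0 : 0 ≤ u' := hm'.trans hm'u
  have hv'u' : v' ≤ u' / lam := by rw [le_div_iff₀ hlam, mul_comm]; exact hv'u
  refine max_le ?_ ?_
  · -- the `m` row
    calc m ≤ T₁₁ * m' + T₁₂ * v' + a := hm
      _ ≤ T₁₁ * u' + T₁₂ * (u' / lam) + max a (lam * b) := by
          have e1 := mul_le_mul_of_nonneg_left hm'u h11
          have e2 := mul_le_mul_of_nonneg_left hv'u' h12
          have e3 := le_max_left a (lam * b)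
          linarith
      _ = (T₁₁ + T₁₂ / lam) * u' + max a (lam * b) := by ring
      _ ≤ max (T₁₁ + T₁₂ / lam) (lam * T₂₁ + T₂₂) * u' + max a (lam * b) := by
          have := mul_le_mul_of_nonneg_right (le_max_left (T₁₁ + T₁₂ / lam) (lam * T₂₁ + T₂₂)) hu'0
          linarith
  · -- the `λ·v` row
    calc lam * v ≤ lam * (T₂₁ * m' + T₂₂ * v' + b) := mul_le_mul_of_nonneg_left hv hlam.le
      _ = (lam * T₂₁) * m' + T₂₂ * (lam * v') + lam * b := by ring
      _ ≤ (lam * T₂₁) * u' + T₂₂ * u' + max a (lam * b) := by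
          have e1 := mul_le_mul_of_nonneg_left hm'u (mul_nonneg hlam.le h21)
          have e2 := mul_le_mul_of_nonneg_left hv'u h22
          have e3 := le_max_right a (lam * b)
          linarith
      _ = (lam * T₂₁ + T₂₂) * u' + max a (lam * b) := by ring
      _ ≤ max (T₁₁ + T₁₂ / lam) (lam * T₂₁ + T₂₂) * u' + max a (lam * b) := by
          have := mul_le_mul_of_nonneg_right (le_max_right (T₁₁ + T₁₂ / lam) (lam * T₂₁ + T₂₂)) hu'0
          linarith

/-! ## §4 The weighted two-profile budget -/

/-- ★★★ **THE WEIGHTED TWO-PROFILE TOWER SUM** ((ST)-currency bootstrap).  Nonneg profile `m` and source `a` (any `v`, `b`) on `ℕ` (level `t = 0` is the first level above the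
fibre), nonneg matrix entries, the UPWARD steps `m (t+1) ≤ T₁₁·m t + T₁₂·v t + a (t+1)`, `v (t+1) ≤ T₂₁·m t + T₂₂·v t + b (t+1)`, the start `m 0 ≤ a 0`, `v 0 ≤ b 0`,
weights `λ > 0`, `ε > 0`, and the DECISIVE condition `L·(1+ε)·q² ≤ r < 1` with `q = max (T₁₁ + T₁₂∕λ) (λT₂₁ + T₂₂)` (`L ≥ 0`).  Then for EVERY `k`
    `Σ_{t<k} L^t·(m t)² ≤ ((1+ε⁻¹)∕(1−r))·Σ_{t<k} L^t·((a t)² + λ²·(b t)²)`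
— the constant is K-FREE. [cite: Balaban1985Averaging, Prop. 4 (134)-(135) p.38, (128)-(133) pp.37-38] -/
theorem weighted_two_profile_sum_le (m v a b : ℕ → ℝ) {T₁₁ T₁₂ T₂₁ T₂₂ lam ε L r : ℝ}
    (hm0 : ∀ t, 0 ≤ m t) (ha0 : ∀ t, 0 ≤ a t)
    (h11 : 0 ≤ T₁₁) (h12 : 0 ≤ T₁₂) (h21 : 0 ≤ T₂₁) (h22 : 0 ≤ T₂₂) (hlam : 0 < lam) (hε : 0 < ε) (hL : 0 ≤ L)
    (hstep : ∀ t, m (t + 1) ≤ T₁₁ * m t + T₁₂ * v t + a (t + 1)) (hstep' : ∀ t, v (t + 1) ≤ T₂₁ * m t + T₂₂ * v t + b (t + 1))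
    (hstart : m 0 ≤ a 0) (hstart' : v 0 ≤ b 0)
    (hr : L * ((1 + ε) * (max (T₁₁ + T₁₂ / lam) (lam * T₂₁ + T₂₂)) ^ 2) ≤ r) (hr1 : r < 1) (k : ℕ) :
    ∑ t ∈ range k, L ^ t * (m t) ^ 2 ≤ (1 + ε⁻¹) / (1 - r) * ∑ t ∈ range k, L ^ t * ((a t) ^ 2 + lam ^ 2 * (b t) ^ 2) := by
  set q := max (T₁₁ + T₁₂ / lam) (lam * T₂₁ + T₂₂) with hq
  have hq0 : 0 ≤ q := le_max_of_le_left (add_nonneg h11 (div_nonneg h12 hlam.le))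
  -- the max profile and its squared step
  set u : ℕ → ℝ := fun t => max (m t) (lam * v t) with hu
  set src : ℕ → ℝ := fun t => max (a t) (lam * b t) with hsrc
  have hu0 : ∀ t, 0 ≤ u t := fun t => le_max_of_le_left (hm0 t)
  have hsrc0 : ∀ t, 0 ≤ src t := fun t => le_max_of_le_left (ha0 t)
  have hustep : ∀ t, u (t + 1) ≤ q * u t + src (t + 1) := fun t =>
    max_profile_step h11 h12 h21 h22 hlam (hm0 t) (hstep t) (hstep' t)
  -- squared currency
  set X : ℕ → ℝ := fun t => (u t) ^ 2 with hX
  set C : ℕ → ℝ := fun t => (1 + ε⁻¹) * (src t) ^ 2 with hC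
  have hε1 : 0 ≤ 1 + ε⁻¹ := by positivity
  have hXstep : ∀ t, X (t + 1) ≤ ((1 + ε) * q ^ 2) * X t + C (t + 1) := fun t => by
    have h := sq_le_of_le_mul_add (hu0 (t + 1)) hq0 (hu0 t) hε (hustep t)
    rw [hX, hC]; dsimp only
    nlinarith [h]
  have hXstart : X 0 ≤ C 0 := by
    rw [hX, hC]; dsimp only
    have h0 : u 0 ≤ src 0 := max_le_max hstart (mul_le_mul_of_nonneg_left hstart' hlam.le)
    have h1 : (u 0) ^ 2 ≤ (src 0) ^ 2 := pow_le_pow_left₀ (hu0 0) h0 2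
    have h2 : (src 0) ^ 2 ≤ (1 + ε⁻¹) * (src 0) ^ 2 := by
      have := sq_nonneg (src 0)
      nlinarith [inv_pos.mpr hε]
    exact h1.trans h2
  have hsum := weighted_tower_sum_le_of_start X C (fun t => sq_nonneg _) (by positivity) hL hr hr1 hXstart hXstep k
  -- compare: L^t m_t² ≤ L^t X_t, and L^t C_t ≤ (1+ε⁻¹) L^t (a_t² + λ² b_t²)
  have hleft : ∑ t ∈ range k, L ^ t * (m t) ^ 2 ≤ ∑ t ∈ range k, L ^ t * X t := by
    refine sum_le_sum fun t _ => mul_le_mul_of_nonneg_left ?_ (pow_nonneg hL _)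
    rw [hX]; dsimp only
    exact pow_le_pow_left₀ (hm0 t) (le_max_left _ _) 2
  have hright : ∑ t ∈ range k, L ^ t * C t ≤ (1 + ε⁻¹) * ∑ t ∈ range k, L ^ t * ((a t) ^ 2 + lam ^ 2 * (b t) ^ 2) := by
    rw [mul_sum]
    refine sum_le_sum fun t _ => ?_
    rw [hC]; dsimp only
    have hmax : (src t) ^ 2 ≤ (a t) ^ 2 + lam ^ 2 * (b t) ^ 2 := by
      rw [hsrc]; dsimp only
      rcases le_total (a t) (lam * b t) with h | h
      · rw [max_eq_right h]; nlinarith [sq_nonneg (a t)]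
      · rw [max_eq_left h]; nlinarith [sq_nonneg (lam * b t)]
    have := mul_le_mul_of_nonneg_left hmax (mul_nonneg (pow_nonneg hL t) hε1)
    nlinarith [this]
  have h1r : 0 < 1 - r := by linarith
  calc ∑ t ∈ range k, L ^ t * (m t) ^ 2 ≤ ∑ t ∈ range k, L ^ t * X t := hleft
    _ ≤ (∑ t ∈ range k, L ^ t * C t) / (1 - r) := hsum
    _ ≤ ((1 + ε⁻¹) * ∑ t ∈ range k, L ^ t * ((a t) ^ 2 + lam ^ 2 * (b t) ^ 2)) / (1 - r) :=
        div_le_div_of_nonneg_right hright h1r.le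
    _ = (1 + ε⁻¹) / (1 - r) * ∑ t ∈ range k, L ^ t * ((a t) ^ 2 + lam ^ 2 * (b t) ^ 2) := by ring

end Summit.QuantumFields.YangMills.Theorems.FluctuationComparisonRegPrIntLS2BetaWeightedTwoProfileTowerSum
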